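import Mathlib

/-!
# Solo-blind seat (MatrixMultiplication), s63 — kernel form of the rank-3 family behind door I1⁗ (SHARPEST §2T, CLAIMS c604 (i))

Over any commutative ring `R` with an element `ω` satisfying `ω² + ω + 1 = 0` (a primitive cube root of unity when `3` is
invertible), the sum of the THREE rank-one tensors
  `(Σ_a λ_a ω^{aj} x_a) ⊗ (Σ_b μ_b ω^{bj} y_b) ⊗ (Σ_c ν_c ω^{cj} z_c)`,  `j = 0,1,2`,
has coefficient `3 λ_a μ_b ν_c` at `(a,b,c)` when `a+b+c ≡ 0 (mod 3)` and `0` otherwise.  The surviving index triples are the six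
permutations of `(0,1,2)` (the support of `T_xyz ≅ cw₂`) and the three cubes `(i,i,i)`: this is the two-parameter rank-3 family
`T_xyz + P x₀y₀z₀ + Q x₁y₁z₁ + R x₂y₂z₂`, `PQR = 1`, of Bürgisser–Clausen–Shokrollahi Ex. 15.25(1) / Coppersmith–Winograd 1990 §11, which the
seat's THEOREM T△-rank averages over one character of an arbitrary finite abelian group.  No `ω` content by itself.
-/

namespace Summit.MatrixMultiplication.MatrixMultiplication.Theorems

open Finset BigOperators

section

variable {R : Type*} [CommRing R]

/-- `ω² + ω + 1 = 0` implies `ω³ = 1`. -/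
theorem soloBlind_cubeRoot_pow_three (ω : R) (hω : ω ^ 2 + ω + 1 = 0) : ω ^ 3 = 1 := by
  linear_combination (ω - 1) * hω

/-- The order-3 character sum: `Σ_{j<3} ω^{s j}` is `3` when `3 ∣ s` and `0` otherwise (`s ≤ 6` suffices here; we prove it for all `s`). -/
theorem soloBlind_geomSum_three (ω : R) (hω : ω ^ 2 + ω + 1 = 0) (s : ℕ) :
    (∑ j : Fin 3, ω ^ (s * (j : ℕ))) = if s % 3 = 0 then 3 else 0 := by
  have h3 : ω ^ 3 = 1 := soloBlind_cubeRoot_pow_three ω hω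
  -- reduce `s` modulo 3
  have key : ∀ j : ℕ, ω ^ (s * j) = ω ^ ((s % 3) * j) := by
    intro j
    calc ω ^ (s * j) = ω ^ ((s % 3 + 3 * (s / 3)) * j) := by rw [Nat.mod_add_div]
      _ = ω ^ ((s % 3) * j) * (ω ^ 3) ^ ((s / 3) * j) := by rw [add_mul, pow_add, ← pow_mul, mul_assoc]
      _ = ω ^ ((s % 3) * j) := by rw [h3, one_pow, mul_one]
  simp only [Fin.sum_univ_three, Fin.val_zero, Fin.val_one, Fin.val_two, key]
  have hs : s % 3 < 3 := Nat.mod_lt _ (by norm_num)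
  interval_cases h : s % 3
  · simp; norm_num
  · simp
    linear_combination hω
  · simp
    linear_combination hω + ω * h3

/-- Coefficient of the three-term DFT decomposition at `(a,b,c)`: the rank-3 family of BCS Ex. 15.25(1).
`lam, mu, nu` are the nine free scalars; the coefficient is `3·λ_a μ_b ν_c` on `a+b+c ≡ 0 (mod 3)` and `0` elsewhere. -/
theorem soloBlind_rankThreeFamily_coeff (ω : R) (hω : ω ^ 2 + ω + 1 = 0)
    (lam mu nu : Fin 3 → R) (a b c : Fin 3) :
    (∑ j : Fin 3, (lam a * ω ^ ((a : ℕ) * (j : ℕ))) * (mu b * ω ^ ((b : ℕ) * (j : ℕ))) * (nu c * ω ^ ((c : ℕ) * (j : ℕ))))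
      = if ((a : ℕ) + b + c) % 3 = 0 then 3 * (lam a * mu b * nu c) else 0 := by
  have hsum := soloBlind_geomSum_three ω hω ((a : ℕ) + b + c)
  have hterm : ∀ j : Fin 3,
      (lam a * ω ^ ((a : ℕ) * (j : ℕ))) * (mu b * ω ^ ((b : ℕ) * (j : ℕ))) * (nu c * ω ^ ((c : ℕ) * (j : ℕ)))
        = (lam a * mu b * nu c) * ω ^ (((a : ℕ) + b + c) * (j : ℕ)) := by
    intro j
    rw [add_mul, add_mul, pow_add, pow_add]
    ring
  simp_rw [hterm, ← Finset.mul_sum, hsum]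
  split_ifs <;> ring

/-- The surviving support: `a+b+c ≡ 0 (mod 3)` on `Fin 3` holds exactly for the six permutations of `(0,1,2)` and the three cubes. -/
theorem soloBlind_rankThreeFamily_support (a b c : Fin 3) :
    (((a : ℕ) + b + c) % 3 = 0) ↔
      ((a ≠ b ∧ b ≠ c ∧ a ≠ c) ∨ (a = b ∧ b = c)) := by
  fin_cases a <;> fin_cases b <;> fin_cases c <;> decide

end

end Summit.MatrixMultiplication.MatrixMultiplication.Theorems
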